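import Summits.QuantumFields.YangMills.Theorems.BalabanUVNodesN14LawChannelPushForward

/-!
# BalabanUVNodes ∕ N14 — THE LAW CHANNEL's PUSH-FORWARD, ONE PIECE: the class-space path `(Λ, h)` of a FINE tilt path `(Ψ, Ψ′)` carries road
# III's regularity letters, run B's image piece is run A's tilted by `e^{Λ_1}`, the DRIFT datum is the fine one, the OSC datum is the CONDITIONED one

Cell `pub-ymgap` (HUMAN RULING D-0062, Track A), node N14 = NE1′, seat `pub-ymgap-dag-n14-c` (R134 ACCELERATION, s1), generation 8; cluster
K3⁶ `SpineGivenEndpointR13SepCoPR` (stmt-QuantumFields-20509; `--kind proof --supports … --as helper`, dag-lead WORDS-142).  ADDITIVE — imports the dictionary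
`Thm/BalabanUVNodesN14LawChannelPushForward` (K12a∕a′∕c∕d; through it dag-n19-c's module I `…N19TiltPathCalculus`) ONLY; 0 `def`; edits nothing.
COUNT-NEUTRAL.  Second of four modules (dictionary → THIS → `…N14LawChannelPushForwardRoad`, the junction with road III → `…Toy`, an inhabitant).

WHAT (LENS control memo v6.2 §D (D2), `Sketch-control-g9.lean` 27be075ad5a82fec §1).  For a finite fine law `ν` on a standard Borel space, a
measurable class map `q`, and a fine tilt path `u ↦ Ψ_u` with direction `Ψ′_u` (measurable, pointwise C¹, locally uniformly bounded — road III's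
letters ON THE FINE SPACE), the CLASS-SPACE path is `Λ_u(V) = log ∫ e^{Ψ_u} d(condLaw ν q V)` with the CONDITIONED direction
`h_u(V) = ∫ Ψ′_u d((condLaw ν q V).tilted Ψ_u)`; both enter as definitional hypotheses `hΛ`, `hh` (a consumer supplies `fun _ _ => rfl`).
* §1 K12b ∕ K12b′ LIFTED WITH CREDIT (lens g9, PROVED there; module I's `hasDerivAt_log_integral_exp_tiltPath` FIBREWISE — the fibres are
  probability laws): `hasDerivAt_fibreLogMGF` (`d∕du Λ_u(V) = h_u(V)`), `fibreLogMGF_bounds` (`|Λ_u|, |h_u| ≤ M` on the fine path's balls).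
* §2 ONE PIECE, road III's letters for `(Λ, h)`: `measurable_classPath`, `measurable_classDir`, `hasDerivAt_classPath`, `classPath_bounds`,
  `classPath_zero` (`Ψ_0 = 0 ⇒ Λ_0 = 0`), `exists_bound_at`; ★ `map_withDensity_exp_classPath` (`(e^{Ψ_1}·ν).map q = e^{Λ_1}·(ν.map q)` — III's
  `hB` downstairs, K12a); ★ `integral_classDir_eq` (THE CLASS DRIFT DATUM IS THE FINE DRIFT DATUM: `∫ h_u d((ν.map q).tilted Λ_u) =
  ∫ Ψ′_u d(ν.tilted Ψ_u)`, K12a′ + K12c); ★ `integral_abs_classDir_sub_eq` (THE CLASS OSC DATUM IS THE FINE-SPACE INTEGRAL OF THE CONDITIONED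
  DIRECTION's OSCILLATION: `∫ |h_u − c| d((ν.map q).tilted Λ_u) = ∫ |h_u(qU) − c| d(ν.tilted Ψ_u)` — the (F2″) letter), `integral_abs_classDir_sub_le`
  (≤ the RAW oscillation, K12d — recorded, never used downstream: EXTENSIVE at the record, lens census V56).
HONEST FRAMING.  [folklore] measure theory on hypothesis SHAPES; no estimate of Bałaban's; every law ∕ path in an application is NODE O's ∕
NE5–NE7's object, produced by nobody; NE1′ ∕ NE7 NOT PRINTED for d = 4, NOT proved; N14 ∕ N19 NOT discharged; K3⁶ NOT claimed; counts UNMOVED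
(typed 28∕28 · discharged 5∕27 · A 5∕28); one finite four-torus at fixed `ε` — NOT ℝ⁴, NOT OS, NOT a mass gap, NOT Clay.  0 `def`; 0 `sorry`;
standard axioms.
-/

set_option autoImplicit false

noncomputable section

open MeasureTheory ProbabilityTheory Set Filter Topology
open scoped ENNReal NNReal

namespace YMDAG.N14.LawChannelPushForwardPath

open Literature.MathematicalPhysics.QuantumFieldTheory.Balaban1983to89.T4AveragingDisintegration (condLaw)
open Summit.QuantumFields.YangMills.BalabanUVNodes.N19TiltPathCalculus (integrable_of_abs_le hasDerivAt_log_integral_exp_tiltPath)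
open YMDAG.N14.LawChannelPushForward

/-! ## §1 (K12b ∕ K12b′, lifted with credit) The fibre log-MGF along a fine tilt path is a tilt path fibrewise -/

section Path

variable {α β : Type*} [MeasurableSpace α] [MeasurableSpace β] [StandardBorelSpace β] [Nonempty β]
  (ν : Measure β) [IsFiniteMeasure ν] {q : β → α} {Ψ Ψ' : ℝ → β → ℝ}

/-- **K12b (LENS control g9, PROVED there — lifted with credit).**  For every class point `V`, the fibre log-MGF
`u ↦ log ∫ e^{Ψ_u} d(condLaw ν q V)` of a fine tilt path is differentiable with derivative the FIBRE-TILTED MEAN of the path direction,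
`h_u(V) = ∫ Ψ′_u d((condLaw ν q V).tilted Ψ_u)` — the CONDITIONED direction (one application of module I's `hasDerivAt_log_integral_exp_tiltPath`
FIBREWISE: the fibres are probability laws). [folklore] -/
theorem hasDerivAt_fibreLogMGF (hΨm : ∀ u, Measurable (Ψ u)) (hΨ'm : ∀ u, Measurable (Ψ' u))
    (hΨd : ∀ u x, HasDerivAt (fun v => Ψ v x) (Ψ' u x) u)
    (hbd : ∀ u₀ : ℝ, ∃ ε > 0, ∃ M : ℝ, ∀ u ∈ Metric.ball u₀ ε, ∀ x, |Ψ u x| ≤ M ∧ |Ψ' u x| ≤ M) (V : α) (u₀ : ℝ) :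
    HasDerivAt (fun u => Real.log (∫ U, Real.exp (Ψ u U) ∂(condLaw ν q V)))
      (∫ U, Ψ' u₀ U ∂((condLaw ν q V).tilted (Ψ u₀))) u₀ :=
  hasDerivAt_log_integral_exp_tiltPath (μ := condLaw ν q V) hΨm hΨ'm hΨd (hbd u₀)

/-- **K12b′ (LENS control g9, PROVED there — lifted with credit).**  The class-space exponent and direction inherit the fine path's LOCAL
UNIFORM BOUNDS: `|Λ_u(V)| ≤ M` and `|h_u(V)| ≤ M` on the same balls. [folklore] -/
theorem fibreLogMGF_bounds (hΨm : ∀ u, Measurable (Ψ u))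
    {u₀ ε M : ℝ} (hM : ∀ u ∈ Metric.ball u₀ ε, ∀ x, |Ψ u x| ≤ M ∧ |Ψ' u x| ≤ M)
    (V : α) {u : ℝ} (hu : u ∈ Metric.ball u₀ ε) :
    |Real.log (∫ U, Real.exp (Ψ u U) ∂(condLaw ν q V))| ≤ M ∧
      |∫ U, Ψ' u U ∂((condLaw ν q V).tilted (Ψ u))| ≤ M := by
  have hb : ∀ U, |Ψ u U| ≤ M := fun U => (hM u hu U).1
  obtain ⟨hlo, hhi⟩ := fibreMGF_mem_Icc ν (q := q) (hΨm u) hb V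
  have hIpos := fibreMGF_pos ν (q := q) (hΨm u) hb V
  refine ⟨?_, abs_condDirection_le ν (hΨm u) hb (fun U => (hM u hu U).2) V⟩
  rw [abs_le]
  constructor
  · have := Real.log_le_log (Real.exp_pos _) hlo
    rwa [Real.log_exp] at this
  · have := Real.log_le_log hIpos hhi
    rwa [Real.log_exp] at this

end Path

/-! ## §2 One piece: the class-space path of a fine path has road III's letters, with the fine DRIFT and the CONDITIONED oscillation -/

section OnePiece

variable {α β : Type*} [MeasurableSpace α] [MeasurableSpace β] [StandardBorelSpace β] [Nonempty β]
  (ν : Measure β) [IsFiniteMeasure ν] {q : β → α} {Ψ Ψ' : ℝ → β → ℝ} {Λ h : ℝ → α → ℝ}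

/-- The class-space exponent `Λ_u` is measurable. [folklore] -/
theorem measurable_classPath (hΨm : ∀ u, Measurable (Ψ u))
    (hΛ : ∀ u V, Λ u V = Real.log (∫ U, Real.exp (Ψ u U) ∂(condLaw ν q V))) (u : ℝ) : Measurable (Λ u) :=
  measurable_fibreLogMGF ν (hΨm u) (hΛ u)

/-- The conditioned direction `h_u` is measurable. [folklore] -/
theorem measurable_classDir (hΨm : ∀ u, Measurable (Ψ u)) (hΨ'm : ∀ u, Measurable (Ψ' u))
    (hh : ∀ u V, h u V = ∫ U, Ψ' u U ∂((condLaw ν q V).tilted (Ψ u))) (u : ℝ) : Measurable (h u) :=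
  measurable_condDirection ν (hΨm u) (hΨ'm u) (hh u)

/-- The class-space path is pointwise C¹ in `u` with derivative the conditioned direction (K12b). [folklore] -/
theorem hasDerivAt_classPath (hΨm : ∀ u, Measurable (Ψ u)) (hΨ'm : ∀ u, Measurable (Ψ' u))
    (hΨd : ∀ u x, HasDerivAt (fun v => Ψ v x) (Ψ' u x) u)
    (hbd : ∀ u₀ : ℝ, ∃ ε > 0, ∃ M : ℝ, ∀ u ∈ Metric.ball u₀ ε, ∀ x, |Ψ u x| ≤ M ∧ |Ψ' u x| ≤ M)
    (hΛ : ∀ u V, Λ u V = Real.log (∫ U, Real.exp (Ψ u U) ∂(condLaw ν q V)))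
    (hh : ∀ u V, h u V = ∫ U, Ψ' u U ∂((condLaw ν q V).tilted (Ψ u))) (u : ℝ) (V : α) :
    HasDerivAt (fun v => Λ v V) (h u V) u := by
  have e : (fun v => Λ v V) = fun v => Real.log (∫ U, Real.exp (Ψ v U) ∂(condLaw ν q V)) := funext fun v => hΛ v V
  rw [e, hh u V]
  exact hasDerivAt_fibreLogMGF ν hΨm hΨ'm hΨd hbd V u

/-- The class-space path inherits the local uniform bounds (K12b′). [folklore] -/
theorem classPath_bounds (hΨm : ∀ u, Measurable (Ψ u))
    (hbd : ∀ u₀ : ℝ, ∃ ε > 0, ∃ M : ℝ, ∀ u ∈ Metric.ball u₀ ε, ∀ x, |Ψ u x| ≤ M ∧ |Ψ' u x| ≤ M)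
    (hΛ : ∀ u V, Λ u V = Real.log (∫ U, Real.exp (Ψ u U) ∂(condLaw ν q V)))
    (hh : ∀ u V, h u V = ∫ U, Ψ' u U ∂((condLaw ν q V).tilted (Ψ u))) (u₀ : ℝ) :
    ∃ ε > 0, ∃ M : ℝ, ∀ u ∈ Metric.ball u₀ ε, ∀ V, |Λ u V| ≤ M ∧ |h u V| ≤ M := by
  obtain ⟨ε, hε, M, hM⟩ := hbd u₀
  refine ⟨ε, hε, M, fun u hu V => ?_⟩
  rw [hΛ u V, hh u V]
  exact fibreLogMGF_bounds ν hΨm hM V hu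

/-- The class-space path starts at the image piece: `Ψ_0 = 0 ⇒ Λ_0 = 0`. [folklore] -/
theorem classPath_zero (hΨ0 : ∀ x, Ψ 0 x = 0)
    (hΛ : ∀ u V, Λ u V = Real.log (∫ U, Real.exp (Ψ u U) ∂(condLaw ν q V))) (V : α) : Λ 0 V = 0 := by
  rw [hΛ 0 V]; exact fibreLogMGF_eq_zero ν hΨ0 V

omit [MeasurableSpace β] [StandardBorelSpace β] [Nonempty β] in
/-- A uniform bound of the exponent and the direction AT ONE parameter, read off the local bounds. [folklore] -/
theorem exists_bound_at (hbd : ∀ u₀ : ℝ, ∃ ε > 0, ∃ M : ℝ, ∀ u ∈ Metric.ball u₀ ε, ∀ x, |Ψ u x| ≤ M ∧ |Ψ' u x| ≤ M) (u : ℝ) :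
    ∃ M : ℝ, (∀ x, |Ψ u x| ≤ M) ∧ ∀ x, |Ψ' u x| ≤ M := by
  obtain ⟨ε, hε, M, hM⟩ := hbd u
  exact ⟨M, fun x => (hM u (Metric.mem_ball_self hε) x).1, fun x => (hM u (Metric.mem_ball_self hε) x).2⟩

/-- Run B's image piece is run A's image piece tilted by `e^{Λ_1}` — road III's `hB` for the class-space path (K12a). [folklore] -/
theorem map_withDensity_exp_classPath (hq : Measurable q) (hΨm : ∀ u, Measurable (Ψ u))
    (hbd : ∀ u₀ : ℝ, ∃ ε > 0, ∃ M : ℝ, ∀ u ∈ Metric.ball u₀ ε, ∀ x, |Ψ u x| ≤ M ∧ |Ψ' u x| ≤ M)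
    (hΛ : ∀ u V, Λ u V = Real.log (∫ U, Real.exp (Ψ u U) ∂(condLaw ν q V))) :
    (ν.withDensity fun U => ENNReal.ofReal (Real.exp (Ψ 1 U))).map q =
      (ν.map q).withDensity fun V => ENNReal.ofReal (Real.exp (Λ 1 V)) := by
  obtain ⟨M, hM, -⟩ := exists_bound_at hbd 1
  exact map_withDensity_exp_eq_withDensity_fibreLogMGF ν hq (hΨm 1) hM (hΛ 1)

/-- **THE CLASS DRIFT DATUM IS THE FINE DRIFT DATUM** (K12a′ + K12c): `∫ h_u d((ν.map q).tilted Λ_u) = ∫ Ψ′_u d(ν.tilted Ψ_u)`. [folklore] -/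
theorem integral_classDir_eq (hq : Measurable q) (hΨm : ∀ u, Measurable (Ψ u)) (hΨ'm : ∀ u, Measurable (Ψ' u))
    (hbd : ∀ u₀ : ℝ, ∃ ε > 0, ∃ M : ℝ, ∀ u ∈ Metric.ball u₀ ε, ∀ x, |Ψ u x| ≤ M ∧ |Ψ' u x| ≤ M)
    (hΛ : ∀ u V, Λ u V = Real.log (∫ U, Real.exp (Ψ u U) ∂(condLaw ν q V)))
    (hh : ∀ u V, h u V = ∫ U, Ψ' u U ∂((condLaw ν q V).tilted (Ψ u))) (u : ℝ) :
    ∫ V, h u V ∂((ν.map q).tilted (Λ u)) = ∫ U, Ψ' u U ∂(ν.tilted (Ψ u)) := by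
  obtain ⟨M, hM, hM'⟩ := exists_bound_at hbd u
  rw [← map_tilted_eq_tilted_fibreLogMGF ν hq (hΨm u) hM (hΛ u)]
  exact integral_condDirection_eq ν hq (hΨm u) hM (hΨ'm u) hM' (hh u)

/-- **THE CLASS OSCILLATION DATUM IS THE FINE-SPACE INTEGRAL OF THE CONDITIONED DIRECTION's OSCILLATION** (K12a′ + change of variables):
`∫ |h_u − c| d((ν.map q).tilted Λ_u) = ∫ |h_u(qU) − c| d(ν.tilted Ψ_u)(U)` — the (F2″) letter. [folklore] -/
theorem integral_abs_classDir_sub_eq (hq : Measurable q) (hΨm : ∀ u, Measurable (Ψ u)) (hΨ'm : ∀ u, Measurable (Ψ' u))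
    (hbd : ∀ u₀ : ℝ, ∃ ε > 0, ∃ M : ℝ, ∀ u ∈ Metric.ball u₀ ε, ∀ x, |Ψ u x| ≤ M ∧ |Ψ' u x| ≤ M)
    (hΛ : ∀ u V, Λ u V = Real.log (∫ U, Real.exp (Ψ u U) ∂(condLaw ν q V)))
    (hh : ∀ u V, h u V = ∫ U, Ψ' u U ∂((condLaw ν q V).tilted (Ψ u))) (u c : ℝ) :
    ∫ V, |h u V - c| ∂((ν.map q).tilted (Λ u)) = ∫ U, |h u (q U) - c| ∂(ν.tilted (Ψ u)) := by
  obtain ⟨M, hM, -⟩ := exists_bound_at hbd u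
  have hhm : Measurable (h u) := measurable_classDir ν hΨm hΨ'm hh u
  have hae : AEStronglyMeasurable (fun V => |h u V - c|) ((ν.tilted (Ψ u)).map q) :=
    ((hhm.sub measurable_const).abs).aestronglyMeasurable
  rw [← map_tilted_eq_tilted_fibreLogMGF ν hq (hΨm u) hM (hΛ u), integral_map hq.aemeasurable hae]

/-- … and is at most the RAW fine oscillation (K12d; recorded, never used downstream — the raw letter is EXTENSIVE at the record). [folklore] -/
theorem integral_abs_classDir_sub_le (hq : Measurable q) (hΨm : ∀ u, Measurable (Ψ u)) (hΨ'm : ∀ u, Measurable (Ψ' u))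
    (hbd : ∀ u₀ : ℝ, ∃ ε > 0, ∃ M : ℝ, ∀ u ∈ Metric.ball u₀ ε, ∀ x, |Ψ u x| ≤ M ∧ |Ψ' u x| ≤ M)
    (hΛ : ∀ u V, Λ u V = Real.log (∫ U, Real.exp (Ψ u U) ∂(condLaw ν q V)))
    (hh : ∀ u V, h u V = ∫ U, Ψ' u U ∂((condLaw ν q V).tilted (Ψ u))) (u c : ℝ) :
    ∫ V, |h u V - c| ∂((ν.map q).tilted (Λ u)) ≤ ∫ U, |Ψ' u U - c| ∂(ν.tilted (Ψ u)) := by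
  obtain ⟨M, hM, hM'⟩ := exists_bound_at hbd u
  rw [← map_tilted_eq_tilted_fibreLogMGF ν hq (hΨm u) hM (hΛ u)]
  exact condOsc_le_osc ν hq (hΨm u) hM (hΨ'm u) hM' (hh u) c

end OnePiece

end YMDAG.N14.LawChannelPushForwardPath

end
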